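import Summits.SmoothPoincare4.SmoothPoincare4.Theorems.CylinderEntropyCylinderRungTwoGaussianAreaLeCylDensity
import Summits.SmoothPoincare4.SmoothPoincare4.Theorems.CylinderEntropyCylinderRungTwoKillingFluxDefs
import Summits.SmoothPoincare4.SmoothPoincare4.Theorems.CylinderEntropyCylinderRungTwoHamiltonMonotonicityDensity
import Literature.Geometry.Riemannian.ColdingMinicozziEntropyAreaRatio
import Literature.Geometry.Riemannian.SphericalCylinderEntropy
import HarnessLib

/-!
# Route `CylinderEntropy`, item `ImmortalAreaToFloor` (stmt-SmoothPoincare4-17197):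
# UPPER AREA-RATIO BOUNDS AT ALL SMALL SCALES FROM THE CYLINDER ENTROPY

The one hypothesis of the item that the flow-free core `AreaQuantization` (stmt-SmoothPoincare4-17175) does NOT have
is the bound `λ_cyl(F_t(M)) < 2` on the typed cylinder entropy at EVERY time.  This file turns it into the uniform
upper density bound that every Allard-free line for the item (entropy sheeting at good times; almost-monotonicity at
most points; Vitali / Lipschitz-approximation arguments) consumes first:

* `gaussianArea_le_three_mul_cylEntropy` — there is a universal scale `t₁ > 0` such that for every measurable
  `A ⊆ N = S⁴ × ℝ ⊂ ℝ⁶` of bounded height, every centre `y ∈ N` and every `0 < t ≤ t₁`, the Colding–Minicozzi Gaussian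
  area is dominated by the cylinder entropy: `F_{y,t}(A) ≤ 3 λ_cyl(A)` (landed density-level Cheeger–Yau domination
  `helper_gaussianAreaLeCylDensity` at `δ = 1`, plus `cylDensity ≤ cylEntropy` and the `τ → ∞` end
  `μH⁴(A)/μH⁴(S⁴) ≤ λ_cyl(A)`);
* `euclideanHausdorff_inter_closedBall_le_of_cylEntropy` — hence, with `r₀ = √t₁`, for all `y ∈ N` and
  `0 < R ≤ r₀`: `μHE⁴(A ∩ B̄(y, R)) ≤ 3 e^{1/4} (4π)² R⁴ · λ_cyl(A)` (Colding–Minicozzi's area-ratio bound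
  `measure_inter_closedBall_le_mul_gaussianArea` at the natural scale `t = R²`);
* `hausdorff_inter_closedBall_le_of_thinFlow` — along a smooth cylinder flow `IsCylinderMCF M F ν T` whose slices
  have `λ_cyl < 2`, every slice is uniformly upper Ahlfors-regular at small scales:
  `μH⁴(F_t(M) ∩ B̄(y, R)) ≤ C R⁴` for all `t ≥ T`, `y ∈ N`, `0 < R ≤ r₀`, with ONE constant `C < ⊤` (Mathlib's
  un-normalised `μH⁴ = c⁻¹ μHE⁴`).

Everything is PROVED (no `sorry`, no definition, no named fact).

References: T. H. Colding, W. P. Minicozzi II, *Generic mean curvature flow I*, Ann. of Math. 175 (2012), Lemma 2.9 and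
§8; J. Cheeger, S.-T. Yau, Comm. Pure Appl. Math. 34 (1981) 465–480 (kernel comparison, landed in the tree).
-/

noncomputable section

-- the prescribed namespace `Summit.SmoothPoincare4.SmoothPoincare4.…` repeats `SmoothPoincare4`
set_option linter.dupNamespace false

open MeasureTheory MeasureTheory.Measure Set Filter Metric
open scoped Manifold ContDiff ENNReal NNReal Topology BigOperators

namespace Summit.SmoothPoincare4.SmoothPoincare4.Theorems

open Literature.Geometry.Riemannian
open Literature.Geometry.Riemannian.SphericalCylinderEntropy (cylEntropy cylDensity cylKernel
  measure_ratio_le_cylEntropy hausdorffMeasure_sphere_four_pos hausdorffMeasure_sphere_four_lt_top)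
open Summit.SmoothPoincare4.SmoothPoincare4.Cruxes.CylinderRungTwo.KillingFlux

/-- **Small-scale Gaussian areas are dominated by the cylinder entropy.**  There is a universal `t₁ > 0` such that
for every measurable `A ⊆ N` of bounded height, every centre `y ∈ N` and every scale `0 < t ≤ t₁`,
`F_{y,t}(A) ≤ 3 · λ_cyl(A)`: the landed density-level Cheeger–Yau domination (`helper_gaussianAreaLeCylDensity` with
`δ = 1`) gives `F_{y,t}(A) ≤ 2 F̂_{y,(1+κ)t}(A) + μH⁴(A)/μH⁴(S⁴)`, and both atoms are at most `λ_cyl(A)`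
(`cylDensity ≤ cylEntropy`; `measure_ratio_le_cylEntropy`). [cite: ColdingMinicozzi2012, Lemma 2.9] -/
theorem gaussianArea_le_three_mul_cylEntropy :
    ∃ t₁ : ℝ, 0 < t₁ ∧ ∀ A : Set (EuclideanSpace ℝ (Fin 6)),
      (∀ z ∈ A, ∑ i : Fin 5, z (Fin.castSucc i) ^ 2 = 1) → MeasurableSet A →
      ∀ B : ℝ, (∀ z ∈ A, |z 5| ≤ B) →
      ∀ y : EuclideanSpace ℝ (Fin 6), ∑ i : Fin 5, y (Fin.castSucc i) ^ 2 = 1 →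
      ∀ t : ℝ, 0 < t → t ≤ t₁ → gaussianArea 4 y t A ≤ 3 * cylEntropy A := by
  obtain ⟨κ, hκ0, -, t₁, ht₁, h⟩ := helper_gaussianAreaLeCylDensity 1 one_pos le_rfl
  refine ⟨t₁, ht₁, fun A hAN hAm B hB y hy t ht htle => ?_⟩
  have h1 := h A hAN hAm y hy t ht htle
  have hd : cylDensity A y ((1 + κ) * t) ≤ cylEntropy A := by
    unfold cylEntropy
    exact le_iSup₂_of_le y hy (le_iSup₂_of_le ((1 + κ) * t) (by positivity) le_rfl)
  have hr : (μH[4] (Metric.sphere (0 : EuclideanSpace ℝ (Fin 5)) 1))⁻¹ * μH[4] A ≤ cylEntropy A :=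
    measure_ratio_le_cylEntropy hAm hAN hB
  have h2 : ENNReal.ofReal (1 + 1) = 2 := by norm_num
  calc gaussianArea 4 y t A
      ≤ ENNReal.ofReal (1 + 1) * cylDensity A y ((1 + κ) * t) +
          ENNReal.ofReal 1 * ((μH[4] (Metric.sphere (0 : EuclideanSpace ℝ (Fin 5)) 1))⁻¹ * μH[4] A) := h1
    _ ≤ ENNReal.ofReal (1 + 1) * cylEntropy A + ENNReal.ofReal 1 * cylEntropy A := by gcongr
    _ = 3 * cylEntropy A := by rw [h2, ENNReal.ofReal_one]; ring

/-- **Area ratios at all small scales are bounded by the cylinder entropy.**  With `r₀ = √t₁` (`t₁` from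
`gaussianArea_le_three_mul_cylEntropy`): for every measurable `A ⊆ N` of bounded height, every `y ∈ N` and every
`0 < R ≤ r₀`, `μHE⁴(A ∩ B̄(y,R)) ≤ 3 e^{1/4} (4π)² R⁴ · λ_cyl(A)` (Colding–Minicozzi's bound
`μHE⁴(A ∩ B̄(y,R)) ≤ e^{1/4} (4π)² R⁴ F_{y,R²}(A)` at the natural scale). [cite: ColdingMinicozzi2012, Lemma 2.9] -/
theorem euclideanHausdorff_inter_closedBall_le_of_cylEntropy :
    ∃ r₀ : ℝ, 0 < r₀ ∧ ∀ A : Set (EuclideanSpace ℝ (Fin 6)),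
      (∀ z ∈ A, ∑ i : Fin 5, z (Fin.castSucc i) ^ 2 = 1) → MeasurableSet A →
      ∀ B : ℝ, (∀ z ∈ A, |z 5| ≤ B) →
      ∀ y : EuclideanSpace ℝ (Fin 6), ∑ i : Fin 5, y (Fin.castSucc i) ^ 2 = 1 →
      ∀ R : ℝ, 0 < R → R ≤ r₀ →
        (μHE[4] : Measure (EuclideanSpace ℝ (Fin 6))) (A ∩ closedBall y R) ≤
          ENNReal.ofReal (3 * Real.exp (1 / 4) * (4 * Real.pi) ^ 2 * R ^ 4) * cylEntropy A := by
  obtain ⟨t₁, ht₁, h⟩ := gaussianArea_le_three_mul_cylEntropy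
  refine ⟨Real.sqrt t₁, Real.sqrt_pos.2 ht₁, fun A hAN hAm B hB y hy R hR hRle => ?_⟩
  have hR2 : R ^ 2 ≤ t₁ := by
    calc R ^ 2 ≤ Real.sqrt t₁ ^ 2 := pow_le_pow_left₀ hR.le hRle 2
      _ = t₁ := Real.sq_sqrt ht₁.le
  have hG := h A hAN hAm B hB y hy (R ^ 2) (by positivity) hR2
  have hCM := measure_inter_closedBall_le_mul_gaussianArea 4 y hR A
  have hpow : (4 * Real.pi) ^ (((4 : ℕ) : ℝ) / 2) = (4 * Real.pi) ^ 2 := by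
    rw [show (((4 : ℕ) : ℝ) / 2) = ((2 : ℕ) : ℝ) by norm_num, Real.rpow_natCast]
  rw [hpow] at hCM
  calc (μHE[4] : Measure (EuclideanSpace ℝ (Fin 6))) (A ∩ closedBall y R)
      ≤ ENNReal.ofReal (Real.exp (1 / 4) * (4 * Real.pi) ^ 2 * R ^ 4) * gaussianArea 4 y (R ^ 2) A := hCM
    _ ≤ ENNReal.ofReal (Real.exp (1 / 4) * (4 * Real.pi) ^ 2 * R ^ 4) * (3 * cylEntropy A) := by gcongr
    _ = ENNReal.ofReal (3 * Real.exp (1 / 4) * (4 * Real.pi) ^ 2 * R ^ 4) * cylEntropy A := by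
        rw [← mul_assoc, mul_comm (ENNReal.ofReal _) 3, ← ENNReal.ofReal_ofNat 3,
          ← ENNReal.ofReal_mul (by norm_num : (0 : ℝ) ≤ 3)]
        congr 2
        ring

/-- **Uniform upper Ahlfors regularity of thin cylinder flows at small scales.**  There are ONE constant `C < ⊤` and
ONE radius `r₀ > 0` such that along every smooth mean curvature flow `IsCylinderMCF M F ν T` of closed embedded
cross-sections of `N = S⁴ × ℝ`, every slice with `λ_cyl(F_t(M)) < 2` (`t ≥ T`) satisfies
`μH⁴(F_t(M) ∩ B̄(y,R)) ≤ C R⁴` for all `y ∈ N`, `0 < R ≤ r₀` — Mathlib's un-normalised `μH⁴` being a constant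
multiple of `μHE⁴` (`exists_euclideanHausdorff_six_eq_smul`); the slice is compact (measurable, of bounded height)
and lies in `N`.  This is the item-specific input (absent from `AreaQuantization`) of the entropy-sheeting line.
[cite: ColdingMinicozzi2012, Lemma 2.9] -/
theorem hausdorff_inter_closedBall_le_of_thinFlow :
    ∃ C : ℝ≥0∞, C < ⊤ ∧ ∃ r₀ : ℝ, 0 < r₀ ∧
      ∀ (M : Type) [TopologicalSpace M] [ChartedSpace (EuclideanSpace ℝ (Fin 4)) M] [IsManifold (𝓡 4) ∞ M]
        [CompactSpace M] (F : ℝ → M → EuclideanSpace ℝ (Fin 6)) (ν : ℝ → M → EuclideanSpace ℝ (Fin 6)) (T : ℝ),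
        IsCylinderMCF M F ν T → ∀ t, T ≤ t → cylEntropy (Set.range (F t)) < 2 →
        ∀ y : EuclideanSpace ℝ (Fin 6), ∑ i : Fin 5, y (Fin.castSucc i) ^ 2 = 1 →
        ∀ R : ℝ, 0 < R → R ≤ r₀ →
          μH[4] (Set.range (F t) ∩ closedBall y R) ≤ C * ENNReal.ofReal (R ^ 4) := by
  obtain ⟨r₀, hr₀, h⟩ := euclideanHausdorff_inter_closedBall_le_of_cylEntropy
  obtain ⟨c, hc, hcE⟩ := exists_euclideanHausdorff_six_eq_smul
  refine ⟨(c : ℝ≥0∞)⁻¹ * ENNReal.ofReal (3 * Real.exp (1 / 4) * (4 * Real.pi) ^ 2) * 2, ?_, r₀, hr₀, ?_⟩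
  · refine ENNReal.mul_lt_top (ENNReal.mul_lt_top ?_ ENNReal.ofReal_lt_top) (by simp)
    exact ENNReal.inv_lt_top.2 (by exact_mod_cast pos_iff_ne_zero.2 hc)
  intro M _ _ _ _ F ν T hF t ht hthin y hy R hR hRle
  -- the slice: compact, hence measurable and of bounded height, inside `N`
  have hcpt : IsCompact (Set.range (F t)) :=
    isCompact_range (hF.isSmoothEmbedding t ht).contMDiff.continuous
  have hAm : MeasurableSet (Set.range (F t)) := hcpt.isClosed.measurableSet
  obtain ⟨B, hB⟩ := hcpt.isBounded.exists_norm_le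
  have hB' : ∀ z ∈ Set.range (F t), |z 5| ≤ B := fun z hz =>
    le_trans (by simpa [Real.norm_eq_abs] using PiLp.norm_apply_le z 5) (hB z hz)
  have hAN : ∀ z ∈ Set.range (F t), ∑ i : Fin 5, z (Fin.castSucc i) ^ 2 = 1 := by
    rintro _ ⟨x, rfl⟩
    exact hF.mem_cyl t ht x
  have hE := h (Set.range (F t)) hAN hAm B hB' y hy R hR hRle
  -- convert `μH⁴ = c⁻¹ μHE⁴`
  have hconv : μH[4] (Set.range (F t) ∩ closedBall y R) =
      (c : ℝ≥0∞)⁻¹ * (μHE[4] : Measure (EuclideanSpace ℝ (Fin 6))) (Set.range (F t) ∩ closedBall y R) := by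
    rw [hcE, Measure.smul_apply, ENNReal.smul_def, smul_eq_mul, ← mul_assoc,
      ENNReal.inv_mul_cancel (by exact_mod_cast hc) ENNReal.coe_ne_top, one_mul]
  rw [hconv]
  have hsplit : ENNReal.ofReal (3 * Real.exp (1 / 4) * (4 * Real.pi) ^ 2 * R ^ 4) =
      ENNReal.ofReal (3 * Real.exp (1 / 4) * (4 * Real.pi) ^ 2) * ENNReal.ofReal (R ^ 4) := by
    rw [← ENNReal.ofReal_mul (by positivity)]
  calc (c : ℝ≥0∞)⁻¹ * (μHE[4] : Measure (EuclideanSpace ℝ (Fin 6))) (Set.range (F t) ∩ closedBall y R)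
      ≤ (c : ℝ≥0∞)⁻¹ * (ENNReal.ofReal (3 * Real.exp (1 / 4) * (4 * Real.pi) ^ 2 * R ^ 4) *
          cylEntropy (Set.range (F t))) := by gcongr
    _ ≤ (c : ℝ≥0∞)⁻¹ * (ENNReal.ofReal (3 * Real.exp (1 / 4) * (4 * Real.pi) ^ 2 * R ^ 4) * 2) := by
        gcongr
    _ = (c : ℝ≥0∞)⁻¹ * ENNReal.ofReal (3 * Real.exp (1 / 4) * (4 * Real.pi) ^ 2) * 2 *
          ENNReal.ofReal (R ^ 4) := by
        rw [hsplit]; ring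

end Summit.SmoothPoincare4.SmoothPoincare4.Theorems

end
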